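import Summits.QuantumFields.YangMills.Theorems.BalabanUVNodesN15KingModelGraphPowerCountingSubgraphsKing
import Summits.QuantumFields.YangMills.Theorems.BalabanUVNodesN15KingModelGraphPowerCountingTriangle

/-!
# BalabanUVNodes ∕ N15 — THE KING-MODEL RUNG (PART Δ-c): **THE ELEMENTARY CENSUS OF KING's SUBGRAPH CONDITION** — what §3.5's renormalisation MUST cancel
# (a tadpole line, and every bundle of parallel lines of total degree `dV + Σ e ≤ 0`: the 4-dimensional bubble, King's 3-dimensional sunset and `G∂G` bubble,
# one line each), and a class where NOTHING is to cancel: graphs of `G`-lines without tadpoles or parallel pairs in which every line set spans at least as many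
# vertices as it has lines (pseudoforests) have EVERY sub-line-set of degree `≥ 2` when `2 ≤ dV ≤ 4` — so (3.77) holds along every ordering with margin `1`
# (part Δ-b); the triangle of part Γ-j is the first instance
# (Track A, DAG node N15 = NE2; FAN-OUT v1.1 §N15 s3 «KING-MODEL RUNG … NE2's analogue DECIDED in the model»)

HONEST FRAMING.  Count-neutral (cell `pub-ymgap`, seat `pub-ymgap-dag-n15-e` g28; `--supports stmt-QuantumFields-27366 --as helper` = K3⁸
`SpineGivenEndpointR13SepCoPHV`).  TEMPLATE LITERATURE: C. King, *The U(1) Higgs model. I. The continuum limit*, Commun. Math. Phys. **102** (1986) 649–677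
[King1986], §3.4 p. 664 («every subgraph have positive degree D»), §3.5 pp. 666–667 (renormalisation cancellations, Wick ordering).  Parts Δ-a∕Δ-b reduced King's
(3.77) along every ordering to the ORDERING-FREE condition `PosSubgraphsBy`: every non-empty connected sub-line-set `S` has `dV·(|V(S)| − 1) + Σ_S e_ℓ > γ₁`.
THIS FILE records the elementary census of that condition in King's letters (`dV` = number of dimensions of the vertex sums, `e = 2 − dV` for `G`, `1 − dV` for
`∂G`): NEGATIVE — a tadpole line (`|V| = 1`, degree `e ≤ 0`) and a bundle of parallel lines between two vertices of total degree `dV + Σ e ≤ γ₁` (the bubble of two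
`G`-lines at `dV = 4`, the sunset of three `G`-lines and the `G∂G` bubble at King's `dV = 3`) VIOLATE it — these are the subgraphs King's §3.5 removes by Wick
ordering and mass renormalisation; POSITIVE — with `G`-lines only, no tadpoles, no parallel pair and `|S| ≤ |V(S)|` for every line set (each component carries at
most one independent loop), every non-empty sub-line-set has degree `≥ 2` for `2 ≤ dV ≤ 4`, hence `PosSubgraphsBy γ₁` for every `γ₁ < 2` and, by part Δ-b, (3.77)
with margin `1` along EVERY ordering; the triangle (part Γ-j) is such a graph (checked by `decide`), recovering part Γ-j's `D(H_i) = 2, 4, 2 > 1` without any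
certificate.  Finite combinatorics; King's U(1)∕`A = 0` model bookkeeping; NOT Bałaban's `G(U)`; NOT a node discharge; nothing continuum ∕ ℝ⁴ ∕ OS ∕ mass-gap ∕
Clay.  0 `sorry`; standard axioms.
THE PRINT.  p. 664 [PDF 16]: *«In order that this procedure work, it is necessary that every subgraph have positive degree D. Some of the subgraphs H_i may be
divergent. In Sect. 3.5, we will show how graphs may be added together to form renormalised graphs, in which every subgraph has positive degree.»*; p. 666
[PDF 18]: *«the renormalised graphs {H_ren} produced after cancelling divergences … (i) D(H_i) > 0 for 1 ≤ i ≤ m₁ (3.77)»*.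
WHAT THIS FILE PROVES (namespace `…N15KingModelRung.Graph`).
* §1 letters: `subDeg_const` (`D(S) = dV(|V|−1) + c|S|` for constant exponents), `posSubgraphsBy_mono`, `two_le_card_lineVerts` (no tadpoles ⇒ `|V(S)| ≥ 2`).
* §2 NEGATIVE census: ★ `not_posSubgraphsBy_of_tadpole` (a line with `src = tgt` and `e ≤ γ₁`), ★ `not_posSubgraphsBy_of_bundle` (a non-empty set of parallel lines
  `a → b`, `a ≠ b`, with `dV + Σ e ≤ γ₁`), `not_posSubgraphsBy_bubble_four` (`dV = 4`, two `G`-lines: `4 − 2 − 2 = 0`), `not_posSubgraphsBy_sunset_three` (`dV = 3`,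
  three `G`-lines: `3 − 1 − 1 − 1 = 0`), `not_posSubgraphsBy_GdG_three` (`dV = 3`, one `G` and one `∂G` line: `3 − 1 − 2 = 0`).
* §3 POSITIVE census: ★★ **`two_le_subDeg_pseudoforest`** (no tadpoles, `|S| ≤ |V(S)|` for all `S`, no parallel pair, `2 ≤ dV ≤ 4`, exponents `2 − dV` ⇒ every
  non-empty `S` has `D(S) ≥ 2`), ★★ `posSubgraphsBy_pseudoforest` (`⇒ PosSubgraphsBy γ₁` for `γ₁ < 2`), ★ `posDegreesBy_kingDegList_pseudoforest` ((3.77) with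
  margin `1` along every ordering, by part Δ-b).
* §4 the triangle: `triangle_noTadpole`, `triangle_pseudoforest`, `triangle_noParallel` (by `decide`), ★ `posSubgraphsBy_triangle`, ★ `posDegreesBy_kingDegList_triangle`
  (`PosDegreesBy 1 (kingDegList triSrc triTgt 4 (2 − 4) π)` for every `π` — part Γ-j's `2, 4, 2 > 1` from the subgraph condition, no certificate).
* §5 (ns `…Curved`) King's letters in cyclomatic form: `loopNumber S` (`|S| − |V(S)| + 1`), `dLines κ S` (`#∂G`-lines), `lineExp_eq_sub_ite`, `sum_lineExp_eq`,
  ★ **`subDeg_lineExp_eq`** (`D(S) = 2(|V(S)| − 1) − (dV − 2)·loops(S) − #∂G(S)`), ★ **`posSubgraphsBy_lineExp_iff`** (POSITIVITY ⟺ `(dV − 2)·loops + #∂G + γ₁ <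
  2(|V| − 1)` for every non-empty connected `S` — King's `dV = 3`: `loops + #∂G < 2|V| − 2`).
HONEST SCOPE.  (a) The census is elementary (|V(S)| ≤ 2 negative cases; the pseudoforest class positive); King's actual renormalised graphs (§3.5, Theorem 3.5,
[Ba3]) are NOT classified here.  (b) King's dimensions are `d = 2, 3` (our `dV`); the `dV = 4` rows are bookkeeping tests of the same combinatorics.  (c) King's
U(1)∕`A = 0` model; NOT Bałaban's `G(U)`; NE2∕N15 of record untouched; counts unmoved.  Locators: [King1986] p.664, (3.77) p.666, pp.666–667.
-/
noncomputable section

namespace Summit.QuantumFields.YangMills.BalabanUVNodes.N15KingModelRung.Graph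

open scoped BigOperators
open Finset
open Summit.QuantumFields.YangMills.BalabanUVNodes.N15KingModelRung.Curved (PosDegreesBy kingDegList posDegreesBy_kingDegList_of_posSubgraphsBy)

/-! ## §1 Letters -/

section Letters
variable {nn m : ℕ} {src tgt : Fin m → Fin (nn + 1)}

/-- the degree of a line set with constant exponents: `D(S) = dV·(|V(S)| − 1) + c·|S|`. [cite: King1986, (3.66)–(3.69) p.664] -/
theorem subDeg_const (dV c : ℝ) (S : Finset (Fin m)) :
    subDeg src tgt dV (fun _ => c) S = dV * (((lineVerts src tgt S).card : ℝ) - 1) + c * S.card := by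
  unfold subDeg
  rw [sum_const, nsmul_eq_mul, mul_comm (S.card : ℝ)]

/-- a smaller margin is implied. [folklore] -/
theorem posSubgraphsBy_mono {γ₁ γ₁' dV : ℝ} {e : Fin m → ℝ} (hγ : γ₁' ≤ γ₁) (h : PosSubgraphsBy src tgt γ₁ dV e) : PosSubgraphsBy src tgt γ₁' dV e :=
  fun S hS hc => lt_of_le_of_lt hγ (h S hS hc)

/-- without tadpole lines every non-empty line set spans at least two vertices. [folklore] -/
theorem two_le_card_lineVerts (h1 : ∀ ℓ, src ℓ ≠ tgt ℓ) {S : Finset (Fin m)} (hS : S.Nonempty) : 2 ≤ (lineVerts src tgt S).card := by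
  obtain ⟨ℓ, hℓ⟩ := hS
  have hsub : ({src ℓ, tgt ℓ} : Finset (Fin (nn + 1))) ⊆ lineVerts src tgt S := by
    intro v hv
    rw [mem_insert, mem_singleton] at hv
    rcases hv with rfl | rfl
    · exact src_mem_lineVerts hℓ
    · exact tgt_mem_lineVerts hℓ
  have h := card_le_card hsub
  rwa [card_pair (h1 ℓ)] at h

end Letters

/-! ## §2 The negative census: what the renormalisation must cancel -/

section Negative
variable {nn m : ℕ} {src tgt : Fin m → Fin (nn + 1)}

/-- ★ **A TADPOLE LINE VIOLATES THE SUBGRAPH CONDITION**: a line `ℓ` with `src ℓ = tgt ℓ` is by itself a non-empty connected sub-line-set on ONE vertex, of degree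
`e_ℓ`; so if `e_ℓ ≤ γ₁` (King: `e = 2 − dV ≤ 0`), `PosSubgraphsBy γ₁` fails — the Wick-ordering subtraction of §3.5. [cite: King1986, p.664, pp.666–667] -/
theorem not_posSubgraphsBy_of_tadpole {γ₁ dV : ℝ} {e : Fin m → ℝ} (ℓ : Fin m) (hℓ : src ℓ = tgt ℓ) (he : e ℓ ≤ γ₁) :
    ¬ PosSubgraphsBy src tgt γ₁ dV e := by
  intro hpos
  have hV : lineVerts src tgt ({ℓ} : Finset (Fin m)) = {src ℓ} := by
    ext v
    rw [mem_lineVerts, mem_singleton]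
    constructor
    · rintro ⟨ℓ', hℓ', h⟩
      rw [mem_singleton] at hℓ'
      subst hℓ'
      rcases h with h | h
      · exact h.symm
      · exact (hℓ.trans h).symm
    · intro hv
      exact ⟨ℓ, mem_singleton_self ℓ, Or.inl hv.symm⟩
  have hconn : ∀ u ∈ lineVerts src tgt ({ℓ} : Finset (Fin m)), ∀ v ∈ lineVerts src tgt ({ℓ} : Finset (Fin m)), LConn src tgt {ℓ} u v := by
    intro u hu v hv
    rw [hV, mem_singleton] at hu hv
    rw [hu, hv]
    exact Relation.EqvGen.refl _
  have h := hpos {ℓ} (singleton_nonempty ℓ) hconn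
  unfold subDeg at h
  rw [hV, card_singleton, sum_singleton, Nat.cast_one, sub_self, mul_zero, zero_add] at h
  linarith

/-- ★ **A BUNDLE OF PARALLEL LINES OF TOTAL DEGREE `dV + Σ e ≤ γ₁` VIOLATES THE SUBGRAPH CONDITION**: a non-empty set `S` of lines all running `a → b` (`a ≠ b`) is a
connected sub-line-set on two vertices, of degree `dV + Σ_{ℓ∈S} e_ℓ`. [cite: King1986, p.664, pp.666–667] -/
theorem not_posSubgraphsBy_of_bundle {γ₁ dV : ℝ} {e : Fin m → ℝ} {a b : Fin (nn + 1)} (hab : a ≠ b) {S : Finset (Fin m)} (hS : S.Nonempty)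
    (hends : ∀ ℓ ∈ S, src ℓ = a ∧ tgt ℓ = b) (hdeg : dV + ∑ ℓ ∈ S, e ℓ ≤ γ₁) : ¬ PosSubgraphsBy src tgt γ₁ dV e := by
  intro hpos
  have hV : lineVerts src tgt S = {a, b} := by
    ext v
    rw [mem_lineVerts, mem_insert, mem_singleton]
    constructor
    · rintro ⟨ℓ, hℓ, h | h⟩
      · exact Or.inl (h.symm.trans (hends ℓ hℓ).1)
      · exact Or.inr (h.symm.trans (hends ℓ hℓ).2)
    · obtain ⟨ℓ, hℓ⟩ := hS
      rintro (rfl | rfl)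
      · exact ⟨ℓ, hℓ, Or.inl (hends ℓ hℓ).1⟩
      · exact ⟨ℓ, hℓ, Or.inr (hends ℓ hℓ).2⟩
  have hconn : ∀ u ∈ lineVerts src tgt S, ∀ v ∈ lineVerts src tgt S, LConn src tgt S u v := by
    obtain ⟨ℓ, hℓ⟩ := hS
    have hab' : LConn src tgt S a b := Relation.EqvGen.rel a b ⟨ℓ, hℓ, (hends ℓ hℓ).1, (hends ℓ hℓ).2⟩
    intro u hu v hv
    rw [hV, mem_insert, mem_singleton] at hu hv
    rcases hu with rfl | rfl <;> rcases hv with rfl | rfl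
    · exact Relation.EqvGen.refl _
    · exact hab'
    · exact hab'.symm _ _
    · exact Relation.EqvGen.refl _
  have h := hpos S hS hconn
  unfold subDeg at h
  rw [hV, card_pair hab, Nat.cast_ofNat] at h
  linarith

/-- **THE 4-DIMENSIONAL BUBBLE**: two parallel `G`-lines (`e = 2 − 4 = −2`) at `dV = 4` have degree `4 − 2 − 2 = 0`: not positive. [cite: King1986, p.664] -/
theorem not_posSubgraphsBy_bubble_four {e : Fin m → ℝ} {a b : Fin (nn + 1)} (hab : a ≠ b) {ℓ₁ ℓ₂ : Fin m} (hne : ℓ₁ ≠ ℓ₂)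
    (h₁ : src ℓ₁ = a ∧ tgt ℓ₁ = b) (h₂ : src ℓ₂ = a ∧ tgt ℓ₂ = b) (he₁ : e ℓ₁ = 2 - 4) (he₂ : e ℓ₂ = 2 - 4) :
    ¬ PosSubgraphsBy src tgt 0 4 e := by
  refine not_posSubgraphsBy_of_bundle hab (S := {ℓ₁, ℓ₂}) (insert_nonempty ℓ₁ {ℓ₂}) (fun ℓ hℓ => ?_) ?_
  · rw [mem_insert, mem_singleton] at hℓ
    rcases hℓ with rfl | rfl
    · exact h₁
    · exact h₂
  · rw [sum_pair hne, he₁, he₂]; norm_num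

/-- **KING's 3-DIMENSIONAL SUNSET**: three parallel `G`-lines (`e = 2 − 3 = −1`) at `dV = 3` have degree `3 − 3 = 0`: not positive (the second-order mass
counterterm). [cite: King1986, p.664, pp.666–667] -/
theorem not_posSubgraphsBy_sunset_three {e : Fin m → ℝ} {a b : Fin (nn + 1)} (hab : a ≠ b) {ℓ₁ ℓ₂ ℓ₃ : Fin m} (h12 : ℓ₁ ≠ ℓ₂) (h13 : ℓ₁ ≠ ℓ₃)
    (h23 : ℓ₂ ≠ ℓ₃) (h₁ : src ℓ₁ = a ∧ tgt ℓ₁ = b) (h₂ : src ℓ₂ = a ∧ tgt ℓ₂ = b) (h₃ : src ℓ₃ = a ∧ tgt ℓ₃ = b)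
    (he₁ : e ℓ₁ = 2 - 3) (he₂ : e ℓ₂ = 2 - 3) (he₃ : e ℓ₃ = 2 - 3) : ¬ PosSubgraphsBy src tgt 0 3 e := by
  refine not_posSubgraphsBy_of_bundle hab (S := {ℓ₁, ℓ₂, ℓ₃}) (insert_nonempty ℓ₁ _) (fun ℓ hℓ => ?_) ?_
  · rw [mem_insert, mem_insert, mem_singleton] at hℓ
    rcases hℓ with rfl | rfl | rfl
    · exact h₁
    · exact h₂
    · exact h₃
  · have hn1 : ℓ₁ ∉ ({ℓ₂, ℓ₃} : Finset (Fin m)) := by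
      rw [mem_insert, mem_singleton]; rintro (h | h); exact h12 h; exact h13 h
    rw [sum_insert hn1, sum_pair h23, he₁, he₂, he₃]; norm_num

/-- **KING's 3-DIMENSIONAL `G∂G` BUBBLE**: a `G`-line (`e = −1`) and a `∂G`-line (`e = 1 − 3 = −2`) in parallel at `dV = 3` have degree `3 − 1 − 2 = 0`: not
positive. [cite: King1986, p.664, pp.666–667] -/
theorem not_posSubgraphsBy_GdG_three {e : Fin m → ℝ} {a b : Fin (nn + 1)} (hab : a ≠ b) {ℓ₁ ℓ₂ : Fin m} (hne : ℓ₁ ≠ ℓ₂)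
    (h₁ : src ℓ₁ = a ∧ tgt ℓ₁ = b) (h₂ : src ℓ₂ = a ∧ tgt ℓ₂ = b) (he₁ : e ℓ₁ = 2 - 3) (he₂ : e ℓ₂ = 1 - 3) :
    ¬ PosSubgraphsBy src tgt 0 3 e := by
  refine not_posSubgraphsBy_of_bundle hab (S := {ℓ₁, ℓ₂}) (insert_nonempty ℓ₁ {ℓ₂}) (fun ℓ hℓ => ?_) ?_
  · rw [mem_insert, mem_singleton] at hℓ
    rcases hℓ with rfl | rfl
    · exact h₁
    · exact h₂
  · rw [sum_pair hne, he₁, he₂]; norm_num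

end Negative

/-! ## §3 The positive census: pseudoforests of `G`-lines need no renormalisation for `2 ≤ dV ≤ 4` -/

section Positive
variable {nn m : ℕ} {src tgt : Fin m → Fin (nn + 1)}

/-- ★★ **EVERY SUB-LINE-SET OF A TADPOLE-FREE, PARALLEL-FREE PSEUDOFOREST OF `G`-LINES HAS DEGREE `≥ 2`** (`2 ≤ dV ≤ 4`, exponents `2 − dV`): if `|V(S)| = 2` then `S`
is one line (no parallel pair) and `D = dV + (2 − dV) = 2`; if `|V(S)| ≥ 3` then `|S| ≤ |V(S)|` gives `D ≥ dV(|V|−1) + (2−dV)|V| = 2|V| − dV ≥ 6 − 4`.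
[cite: King1986, p.664 («every subgraph have positive degree»)] -/
theorem two_le_subDeg_pseudoforest (h1 : ∀ ℓ, src ℓ ≠ tgt ℓ) (h2 : ∀ S : Finset (Fin m), S.card ≤ (lineVerts src tgt S).card)
    (h3 : ∀ S : Finset (Fin m), S.card = 2 → 3 ≤ (lineVerts src tgt S).card) {dV : ℝ} (hdV : 2 ≤ dV) (hdV' : dV ≤ 4)
    {S : Finset (Fin m)} (hS : S.Nonempty) : 2 ≤ subDeg src tgt dV (fun _ => 2 - dV) S := by
  rw [subDeg_const]
  have hV2 := two_le_card_lineVerts h1 hS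
  have hSV := h2 S
  have hS1 : 1 ≤ S.card := card_pos.2 hS
  by_cases hV : (lineVerts src tgt S).card = 2
  · -- two vertices: a single line
    have hS2 : S.card ≠ 2 := fun h => by have := h3 S h; omega
    have hS1' : S.card = 1 := by omega
    rw [hV, hS1']
    norm_num
  · -- at least three vertices
    have hV3 : 3 ≤ (lineVerts src tgt S).card := by omega
    have hv : (3 : ℝ) ≤ ((lineVerts src tgt S).card : ℝ) := by exact_mod_cast hV3
    have hsv : (S.card : ℝ) ≤ ((lineVerts src tgt S).card : ℝ) := by exact_mod_cast hSV
    nlinarith [mul_nonneg (sub_nonneg.2 hdV) (sub_nonneg.2 hsv)]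

/-- ★★ **SUCH GRAPHS SATISFY KING's SUBGRAPH CONDITION WITH EVERY MARGIN `γ₁ < 2`** (nothing to renormalise). [cite: King1986, p.664] -/
theorem posSubgraphsBy_pseudoforest (h1 : ∀ ℓ, src ℓ ≠ tgt ℓ) (h2 : ∀ S : Finset (Fin m), S.card ≤ (lineVerts src tgt S).card)
    (h3 : ∀ S : Finset (Fin m), S.card = 2 → 3 ≤ (lineVerts src tgt S).card) {dV : ℝ} (hdV : 2 ≤ dV) (hdV' : dV ≤ 4) {γ₁ : ℝ} (hγ₁ : γ₁ < 2) :
    PosSubgraphsBy src tgt γ₁ dV (fun _ => 2 - dV) :=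
  fun _ hS _ => lt_of_lt_of_le hγ₁ (two_le_subDeg_pseudoforest h1 h2 h3 hdV hdV' hS)

/-- ★ **HENCE (3.77) WITH MARGIN `1` ALONG EVERY ORDERING** for such graphs (part Δ-b `posDegreesBy_kingDegList_of_posSubgraphsBy`). [cite: King1986, (3.77) p.666] -/
theorem posDegreesBy_kingDegList_pseudoforest (h1 : ∀ ℓ, src ℓ ≠ tgt ℓ) (h2 : ∀ S : Finset (Fin m), S.card ≤ (lineVerts src tgt S).card)
    (h3 : ∀ S : Finset (Fin m), S.card = 2 → 3 ≤ (lineVerts src tgt S).card) {dV : ℝ} (hdV : 2 ≤ dV) (hdV' : dV ≤ 4) (π : Equiv.Perm (Fin m)) :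
    PosDegreesBy 1 (kingDegList src tgt dV (fun _ => 2 - dV) π) :=
  posDegreesBy_kingDegList_of_posSubgraphsBy zero_le_one (posSubgraphsBy_pseudoforest h1 h2 h3 hdV hdV' (by norm_num)) π

end Positive

/-! ## §4 The triangle of part Γ-j through the subgraph condition -/

section Triangle
open Summit.QuantumFields.YangMills.BalabanUVNodes.N15KingModelRung.Curved (triSrc triTgt)

/-- the triangle has no tadpole line. [folklore] -/
theorem triangle_noTadpole : ∀ ℓ : Fin 3, triSrc ℓ ≠ triTgt ℓ := by decide

/-- every line set of the triangle spans at least as many vertices as it has lines. [folklore] -/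
theorem triangle_pseudoforest : ∀ S : Finset (Fin 3), S.card ≤ (lineVerts triSrc triTgt S).card := by decide

/-- the triangle has no parallel pair. [folklore] -/
theorem triangle_noParallel : ∀ S : Finset (Fin 3), S.card = 2 → 3 ≤ (lineVerts triSrc triTgt S).card := by decide

/-- ★ **THE TRIANGLE SATISFIES KING's SUBGRAPH CONDITION** at `dV = 4` with three `G`-lines, every margin `γ₁ < 2`. [cite: King1986, p.664] -/
theorem posSubgraphsBy_triangle {γ₁ : ℝ} (hγ₁ : γ₁ < 2) : PosSubgraphsBy triSrc triTgt γ₁ 4 (fun _ => 2 - 4) :=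
  posSubgraphsBy_pseudoforest triangle_noTadpole triangle_pseudoforest triangle_noParallel (by norm_num) le_rfl hγ₁

/-- ★ **HENCE `D(H_i) > 1` ALONG EVERY ORDERING OF THE TRIANGLE, WITH NO CERTIFICATE** — part Γ-j's `2, 4, 2 > 1` recovered from the subgraph condition.
[cite: King1986, (3.66) p.663, (3.77) p.666] -/
theorem posDegreesBy_kingDegList_triangle (π : Equiv.Perm (Fin 3)) : PosDegreesBy 1 (kingDegList triSrc triTgt 4 (fun _ => 2 - 4) π) :=
  posDegreesBy_kingDegList_pseudoforest triangle_noTadpole triangle_pseudoforest triangle_noParallel (by norm_num) le_rfl π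

end Triangle

end Summit.QuantumFields.YangMills.BalabanUVNodes.N15KingModelRung.Graph

/-! ## §5 King's letters: positivity ⟺ few loops and few `∂G` lines (the cyclomatic form of the degree) -/

namespace Summit.QuantumFields.YangMills.BalabanUVNodes.N15KingModelRung.Curved

open scoped BigOperators
open Finset
open Summit.QuantumFields.YangMills.BalabanUVNodes.N15KingModelRung.Graph

section Cyclomatic
variable {nn m : ℕ} (src tgt : Fin m → Fin (nn + 1))

/-- **THE LOOP NUMBER** `|S| − |V(S)| + 1` of a line set (its cyclomatic number — the number of independent loops — when `S` is connected). [folklore] -/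
def loopNumber (S : Finset (Fin m)) : ℤ := (S.card : ℤ) - ((lineVerts src tgt S).card : ℤ) + 1

/-- the number of `∂G`-lines (kind `some μ`) in a line set. [cite: King1986, (3.63) p.663] -/
def dLines {dd : ℕ} (κ : Fin m → Option (Fin dd)) (S : Finset (Fin m)) : ℕ := (S.filter fun ℓ => (κ ℓ).isSome).card

variable {src tgt}

/-- King's line exponent as «`2 − dV`, minus one for a derivative». [cite: King1986, (3.63) p.663] -/
theorem lineExp_eq_sub_ite {dd : ℕ} (κ : Option (Fin dd)) : lineExp dd κ = ((2 : ℝ) - dd) - if κ.isSome then 1 else 0 := by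
  cases κ with
  | none => rw [lineExp_none, Option.isSome_none]; simp
  | some μ => rw [lineExp_some, Option.isSome_some, if_pos rfl]; ring

/-- the total line power of a line set: `Σ_S e = (2 − dV)|S| − #∂G-lines`. [cite: King1986, (3.63) p.663, (3.66) p.664] -/
theorem sum_lineExp_eq {dd : ℕ} (κ : Fin m → Option (Fin dd)) (S : Finset (Fin m)) :
    ∑ ℓ ∈ S, lineExp dd (κ ℓ) = ((2 : ℝ) - dd) * S.card - (dLines κ S : ℝ) := by
  simp_rw [lineExp_eq_sub_ite]
  rw [sum_sub_distrib, sum_const, nsmul_eq_mul, mul_comm, sum_boole]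
  rfl

/-- ★ **KING's DEGREE IN CYCLOMATIC FORM**: for `G`∕`∂G` lines in `dV` dimensions, `D(S) = dV(|V(S)| − 1) + Σ_S e_ℓ = 2(|V(S)| − 1) − (dV − 2)·(|S| − |V(S)| + 1) −
#∂G(S)` — the superficial degree of convergence falls by `dV − 2` per independent loop and by `1` per derivative line. [cite: King1986, (3.63) p.663, (3.66) p.664] -/
theorem subDeg_lineExp_eq {dd : ℕ} (κ : Fin m → Option (Fin dd)) (S : Finset (Fin m)) :
    subDeg src tgt (dd : ℝ) (fun ℓ => lineExp dd (κ ℓ)) S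
      = 2 * (((lineVerts src tgt S).card : ℝ) - 1) - ((dd : ℝ) - 2) * (loopNumber src tgt S : ℝ) - (dLines κ S : ℝ) := by
  unfold subDeg loopNumber
  rw [sum_lineExp_eq]
  push_cast
  ring

/-- ★ **POSITIVITY ⟺ FEW LOOPS AND FEW DERIVATIVE LINES**: King's subgraph condition with margin `γ₁` for `G`∕`∂G` lines in `dV` dimensions reads: every non-empty
connected sub-line-set `S` has `(dV − 2)·loops(S) + #∂G(S) + γ₁ < 2(|V(S)| − 1)` — in King's `dV = 3`: `loops + #∂G < 2|V| − 2 − γ₁`; what §3.5's renormalised graphs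
must satisfy, subgraph by subgraph. [cite: King1986, p.664 («every subgraph have positive degree»), (3.77) p.666] -/
theorem posSubgraphsBy_lineExp_iff {dd : ℕ} (κ : Fin m → Option (Fin dd)) (γ₁ : ℝ) :
    PosSubgraphsBy src tgt γ₁ (dd : ℝ) (fun ℓ => lineExp dd (κ ℓ))
      ↔ ∀ S : Finset (Fin m), S.Nonempty → (∀ u ∈ lineVerts src tgt S, ∀ v ∈ lineVerts src tgt S, LConn src tgt S u v) →
          ((dd : ℝ) - 2) * (loopNumber src tgt S : ℝ) + (dLines κ S : ℝ) + γ₁ < 2 * (((lineVerts src tgt S).card : ℝ) - 1) := by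
  unfold PosSubgraphsBy
  refine forall_congr' fun S => forall_congr' fun _ => forall_congr' fun _ => ?_
  rw [subDeg_lineExp_eq]
  constructor <;> intro h <;> linarith

end Cyclomatic

end Summit.QuantumFields.YangMills.BalabanUVNodes.N15KingModelRung.Curved

end
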